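import Mathlib
import HarnessLib
import Summits.HubbardSuperconductivity.HubbardSuperconductivity.Theorems.KLProgrammeKLRegimeEngineScaleZeroOverlapL1
import Summits.HubbardSuperconductivity.HubbardSuperconductivity.Theorems.KLProgrammeKLRegimeTorusL1ThirdDifferencesMoment

/-!
# KL programme — K3 ENGINE child (`KLRegimeEngineV17F2`, stmt-HubbardSuperconductivity-20437): the WEIGHTED single-family torus bound from
# symbol data — the sup, the support count and single-direction THIRD differences of the padded multiplier symbol in the five directions
# (time, the two axes, the integer sector frame `(v⊥, v)`)

Cell `gate-hubbard-kl`, seat p3 (g9); W1 of the (E4)ₙ supply (KL STATUS plan g17 13:32:55Z: «aniso + weight twin of `IsoTorusBoundAt` at scale n,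
`T_w(n)` n-free»), located risk «(b)-Wt@j≥1».  k3c2-p1's `torusSum_le_of_symbol_bounds` (…ScaleZeroOverlapL1) turns sup/support/SECOND
differences of a multiplier family `F_ω` on `FreqMomentum L M` (padded by zero to `(ℤ/4M) × (ℤ/L)²`) into the PLAIN torus bound
`(|β|L²)⁻¹ Σ_{(d,w)} ‖Σ_k F_ω(k) Χ_c(k; d, w)‖ ≤ …` that p4's `IsoTorusBoundAt` instance consumes (isotropic frame `v = e₁`).  This file is its
WEIGHTED, ORDER-THREE, GENERAL-FRAME twin through the master lemma `sum_wt_norm_charSum_le_of_third_differences`: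

  **`torusSumWt_le_of_symbol_bounds`** — if `conj F_ω = F_ω`, `‖F_ω‖ ≤ 1`, the padded symbol has support `≤ N_s` and pointwise THIRD
  differences `≤ (4/(s₀·4M))³` (time), `≤ (4/(s₁L))³` (axes), `≤ (4/(s₂L))³` (`v⊥`), `≤ (4/(s₃L))³` (`v`), then for every sector `ω` and charge `c`
  `(|β|L²)⁻¹ Σ_{(d,w)} (1 + s₀|d̃| + s₁|w̃₁| + s₁|w̃₂|)·‖Σ_k F_ω(k) Χ_c(k; d, w)‖
     ≤ (|β|L²)⁻¹ · √(32768(1/s₀+1)[C_w²·4(2√2/(s₂|v|)+2)(2√2/(s₃|v|)+2) + 16(1/s₁+1)²/(1+s₁R₀)]) · √(21·4M·L²·N_s)`,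
  `C_w = 1 + 2√2s₁/(s₂|v|) + 2√2s₁/(s₃|v|)`, for every near radius `R₀` with `2(|v₁|+|v₂|)R₀ < L`.

The weight `1 + s₀|d̃| + s₁|w̃|₁` dominates `1 + Λ·((β/4M)·cyclicDist_{4M}(d) + torusSiteDist(w))` whenever `Λβ/(4M) ≤ s₀`, `Λ ≤ s₁`
(`cyclicDist = |valMinAbs|`, `torusSiteDist ≤ ℓ¹`; `…EngineScaleWtSliceRows` §1), i.e. the scale-`n` tree weight of `klScaleWt`.  What the
instance supplies (iso family: `v = e₁`; aniso family `klAnisoFamily … n ω`: `v` = the integer tangent of sector `ω`, `|v| ≍ 2ⁿ`): rates and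
the order-three multiplier data (p4 lineage, next to its order-two pack `…IsoSymbolDiffs` / (b₂)(b₃)).
Everything is proved; no definitions, no named facts, no sorry.  Nothing asserts superconductivity.
-/

noncomputable section

namespace Summit.HubbardSuperconductivity.HubbardSuperconductivity.Theorems.EngineV8

set_option linter.dupNamespace false -- summit = problem name (single-conjunct summit), D-0017

open Real Finset Literature.MathematicalPhysics.QuantumLattice Literature.Probability.LatticeModels
open Summit.HubbardSuperconductivity.HubbardSuperconductivity.Theorems.KLRegimeSplit
open Summit.HubbardSuperconductivity.HubbardSuperconductivity.Theorems.DispersionFlow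
open Summit.HubbardSuperconductivity.HubbardSuperconductivity.Theorems.KLProgrammeLegKernels
open Summit.HubbardSuperconductivity.HubbardSuperconductivity.Theorems.TorusFourierL2
open scoped ComplexConjugate

variable {L M : ℕ} [NeZero L] {Ns : ℕ}

/-- **The WEIGHTED single-family torus bound from symbol data** (one position moment, third single-direction differences, general sector frame):
for a real multiplier family `F_ω` with `‖F_ω‖ ≤ 1`, padded-symbol support `≤ N_s`, and pointwise third differences of the padded symbol
`≤ (4/(s₀·4M))³` (time), `≤ (4/(s₁L))³` (both axes), `≤ (4/(s₂L))³` (direction `v⊥`), `≤ (4/(s₃L))³` (direction `v`), every `ω`, `c`: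
`(|β|L²)⁻¹ Σ_{(d,w)} (1 + s₀|d̃| + s₁|w̃₁| + s₁|w̃₂|)·‖Σ_k F_ω(k) Χ_c(k;(d,w))‖
  ≤ (|β|L²)⁻¹·√(32768(1/s₀+1)[C_w²·4(2√2/(s₂|v|)+2)(2√2/(s₃|v|)+2) + 16(1/s₁+1)²/(1+s₁R₀)])·√(21·4M·L²·N_s)`.
[cite: BenfattoGiulianiMastropietro2006, Lemma 2.2 (2.52), §2.6 (2.81) and footnote 1] -/
theorem torusSumWt_le_of_symbol_bounds [NeZero M] (β : ℝ) (F : Fin Ns → FreqMomentum L M → ℂ)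
    (hreal : ∀ ω k, conj (F ω k) = F ω k) (hF1 : ∀ ω k, ‖F ω k‖ ≤ 1)
    (v : Fin 2 → ℤ) (hv : v ≠ 0) {s₀ s₁ s₂ s₃ : ℝ} (hs₀ : 0 < s₀) (hs₁ : 0 < s₁) (hs₂ : 0 < s₂) (hs₃ : 0 < s₃)
    {R₀ : ℕ} (hR₀ : 2 * (|v 0| + |v 1|) * (R₀ : ℤ) < L) {Nsupp : ℕ}
    (hsupp : ∀ ω, (univ.filter fun q : TorusSite 1 (2 * (2 * M)) × TorusSite 2 L =>
      (if h : (q.1 0).val < 2 * M then F ω (⟨(q.1 0).val, h⟩, q.2) else 0) ≠ 0).card ≤ Nsupp)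
    (h₀ : ∀ ω q, ‖(fwdDiff ((fun _ : Fin 1 => (1 : ZMod (2 * (2 * M)))), (0 : TorusSite 2 L)))^[3]
      (fun q : TorusSite 1 (2 * (2 * M)) × TorusSite 2 L =>
        if h : (q.1 0).val < 2 * M then F ω (⟨(q.1 0).val, h⟩, q.2) else 0) q‖ ≤ (4 / (s₀ * (2 * (2 * M) : ℕ))) ^ 3)
    (h₁ : ∀ ω q (i : Fin 2), ‖(fwdDiff ((0 : TorusSite 1 (2 * (2 * M))), (Pi.single i (1 : ZMod L) : TorusSite 2 L)))^[3]
      (fun q : TorusSite 1 (2 * (2 * M)) × TorusSite 2 L =>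
        if h : (q.1 0).val < 2 * M then F ω (⟨(q.1 0).val, h⟩, q.2) else 0) q‖ ≤ (4 / (s₁ * L)) ^ 3)
    (h₂ : ∀ ω q, ‖(fwdDiff ((0 : TorusSite 1 (2 * (2 * M))), (fun j => ((![-v 1, v 0] j : ℤ) : ZMod L))))^[3]
      (fun q : TorusSite 1 (2 * (2 * M)) × TorusSite 2 L =>
        if h : (q.1 0).val < 2 * M then F ω (⟨(q.1 0).val, h⟩, q.2) else 0) q‖ ≤ (4 / (s₂ * L)) ^ 3)
    (h₃ : ∀ ω q, ‖(fwdDiff ((0 : TorusSite 1 (2 * (2 * M))), (fun j => ((v j : ℤ) : ZMod L))))^[3]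
      (fun q : TorusSite 1 (2 * (2 * M)) × TorusSite 2 L =>
        if h : (q.1 0).val < 2 * M then F ω (⟨(q.1 0).val, h⟩, q.2) else 0) q‖ ≤ (4 / (s₃ * L)) ^ 3)
    (ω : Fin Ns) (c : Fin 2) :
    1 / (|β| * (L : ℝ) ^ 2) *
        ∑ dw : TorusSite 1 (2 * (2 * M)) × TorusSite 2 L,
          (1 + s₀ * |(((dw.1 0).valMinAbs : ℤ) : ℝ)| + s₁ * |(((dw.2 0).valMinAbs : ℤ) : ℝ)| + s₁ * |(((dw.2 1).valMinAbs : ℤ) : ℝ)|) *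
          ‖∑ k : FreqMomentum L M, F ω k *
            (if c = 0 then torusChar (fun _ : Fin 1 => ((k.1 : ℕ) : ZMod (2 * (2 * M)))) dw.1 * torusChar k.2 dw.2
              else conj (torusChar (fun _ : Fin 1 => ((k.1 : ℕ) : ZMod (2 * (2 * M)))) dw.1 * torusChar k.2 dw.2))‖ ≤
      1 / (|β| * (L : ℝ) ^ 2) *
        (Real.sqrt (32768 * (1 / s₀ + 1) *
            ((1 + 2 * Real.sqrt 2 * s₁ / (s₂ * Real.sqrt ((v 0 : ℝ) ^ 2 + (v 1 : ℝ) ^ 2)) +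
                2 * Real.sqrt 2 * s₁ / (s₃ * Real.sqrt ((v 0 : ℝ) ^ 2 + (v 1 : ℝ) ^ 2))) ^ 2 *
              (4 * ((2 * Real.sqrt 2 / (s₂ * Real.sqrt ((v 0 : ℝ) ^ 2 + (v 1 : ℝ) ^ 2)) + 2) *
                (2 * Real.sqrt 2 / (s₃ * Real.sqrt ((v 0 : ℝ) ^ 2 + (v 1 : ℝ) ^ 2)) + 2)))
              + 16 * (1 / s₁ + 1) ^ 2 / (1 + s₁ * R₀))) *
          Real.sqrt (21 * (2 * (2 * M) : ℕ) * (L : ℝ) ^ 2 * Nsupp)) := by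
  classical
  haveI : NeZero (2 * (2 * M)) := ⟨by have := NeZero.ne M; omega⟩
  refine mul_le_mul_of_nonneg_left ?_ (by positivity)
  -- reduce the conjugate orientation to the direct one
  have hc : ∀ dw : TorusSite 1 (2 * (2 * M)) × TorusSite 2 L, ‖∑ k : FreqMomentum L M, F ω k *
      (if c = 0 then torusChar (fun _ : Fin 1 => ((k.1 : ℕ) : ZMod (2 * (2 * M)))) dw.1 * torusChar k.2 dw.2
        else conj (torusChar (fun _ : Fin 1 => ((k.1 : ℕ) : ZMod (2 * (2 * M)))) dw.1 * torusChar k.2 dw.2))‖ =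
      ‖∑ k : FreqMomentum L M, F ω k *
        (torusChar (fun _ : Fin 1 => ((k.1 : ℕ) : ZMod (2 * (2 * M)))) dw.1 * torusChar k.2 dw.2)‖ := by
    intro dw
    by_cases hc0 : c = 0
    · simp only [hc0, if_true]
    · simp only [hc0, if_false]
      exact norm_charSum_conj_eq F hreal ω dw.1 dw.2
  simp_rw [hc, charSum_freqMomentum_eq_charSum_padded F ω]
  -- the padded symbol
  set G : TorusSite 1 (2 * (2 * M)) × TorusSite 2 L → ℂ := fun q =>
    if h : (q.1 0).val < 2 * M then F ω (⟨(q.1 0).val, h⟩, q.2) else 0 with hG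
  have hsup : ∀ q, ‖G q‖ ≤ 1 := fun q => by
    rw [hG]
    dsimp only
    split_ifs
    · exact hF1 ω _
    · rw [norm_zero]; exact zero_le_one
  -- the master lemma at `A₀ = 1`
  have hmain := sum_wt_norm_charSum_le_of_third_differences G v hv hs₀ hs₁ hs₂ hs₃ hR₀ zero_le_one (hsupp ω) hsup
    (fun q => by rw [one_mul]; exact h₀ ω q)
    (fun q i => by rw [one_mul]; exact h₁ ω q i)
    (fun q => by rw [one_mul]; exact h₂ ω q)
    (fun q => by rw [one_mul]; exact h₃ ω q)
  rw [mul_one] at hmain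
  convert hmain using 2

end Summit.HubbardSuperconductivity.HubbardSuperconductivity.Theorems.EngineV8

end
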